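import Literature.Geometry.MetricGeometry.MengerSegments
import Literature.Geometry.MetricGeometry.PointedGromovHausdorff
import HarnessLib

/-!
# Pointed Gromov–Hausdorff limits of geodesic spaces are geodesic

Huang–Huang–Wang–Zhu 2026, §4 (pp. 13–14) work in the pointed Gromov–Hausdorff limit
`(M̂ᵢ, p̂ᵢ) → ℝˢ × Ŷ` of the Riemannian covers `M̂ᵢ` and in its quotient `X̄ = (ℝˢ × Ŷ)/H₀` as in
geodesic spaces ("connect `y₁, y₂` by a geodesic `η`", p. 14; lines and the splitting theorem in the
limit, p. 13). The metric fact behind this is that midpoints pass to pointed Gromov–Hausdorff limits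
of proper spaces, whence (Menger, `MengerSegments.lean`) the limit is geodesic. In the tree's
vocabulary (`PointedGHConv`, `IsPointedGHApprox` of `PointedGromovHausdorff.lean`):

* `PointedGHConv.exists_midpoint` — if `(Xᵢ, pᵢ) → (Y, q)`, `Y` is proper and every `Xᵢ` has
  midpoints, then `Y` has midpoints (transport midpoints of preimages by pointed approximations of
  large radius and small error to get approximate midpoints; `exists_midpoint_of_forall_approx`);
* `PointedGHConv.exists_segment` — hence **`Y` is geodesic**: unit-speed minimal segments between
  any two points (`exists_segment_of_exists_midpoint`);
* `PointedGHConv.exists_segment_of_forall_exists_segment` — the same from geodesic `Xᵢ`.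

Everything is proved; no definitions, no named facts.

## References

* H. Huang, X.-T. Huang, J. Wang, X. Zhu, arXiv:2605.24380 (2026), §2.1 p. 6, §4 pp. 13–14.
  [HuangHuangWangZhu2026]
* B. O'Neill, *Semi-Riemannian Geometry* (1983), Ch. 5, Prop. 22 (segments from midpoints).
  [ONeill1983]
-/

noncomputable section

open Set Filter Metric Topology

namespace Literature.Geometry.MetricGeometry

variable {X : ℕ → Type*} [∀ i, PseudoMetricSpace (X i)] {Y : Type*} [MetricSpace Y] [ProperSpace Y]
  {p : ∀ i, X i} {q : Y}

/-- **Midpoints pass to pointed Gromov–Hausdorff limits**: if `(Xᵢ, pᵢ) → (Y, q)` in the pointed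
Gromov–Hausdorff sense, `Y` is proper, and in every `Xᵢ` any two points have a midpoint, then any
two points of `Y` have a midpoint. Given `y, y'` and `ε > 0`, a pointed `(r, ε/4)`-approximation
`f : Xᵢ → Y` of radius `r` large against `d(q, y) + d(q, y')` has preimages `x, x'` of `y, y'` up to
`ε/4`; the image `f m` of a midpoint `m` of `x, x'` is a midpoint of `y, y'` up to `ε`; conclude by
`exists_midpoint_of_forall_approx`. [cite: HuangHuangWangZhu2026, §2.1 p. 6 and §4 pp. 13–14] -/
theorem PointedGHConv.exists_midpoint (h : PointedGHConv p q)
    (hmid : ∀ i, ∀ x x' : X i, ∃ m, dist x m = dist x x' / 2 ∧ dist m x' = dist x x' / 2)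
    (y y' : Y) : ∃ m : Y, dist y m = dist y y' / 2 ∧ dist m y' = dist y y' / 2 := by
  refine exists_midpoint_of_forall_approx fun ε hε ↦ ?_
  -- radius and error of the approximation
  set R : ℝ := dist y q + dist y' q + 1 with hR
  have hR0 : 0 ≤ dist y q + dist y' q := add_nonneg dist_nonneg dist_nonneg
  set η : ℝ := min (ε / 4) 1 with hη
  have hη0 : 0 < η := lt_min (by positivity) one_pos
  have hηε : η ≤ ε / 4 := min_le_left _ _
  have hη1 : η ≤ 1 := min_le_right _ _
  obtain ⟨i, f, hf⟩ := (h (4 * R + 10) η hη0).exists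
  have hpi : p i ∈ closedBall (p i) (4 * R + 10) := mem_closedBall_self (by positivity)
  -- preimages of `y`, `y'`
  have hyb : y ∈ closedBall q (4 * R + 10 - 2 * η) := mem_closedBall.2 (by linarith [dist_nonneg (x := y') (y := q)])
  have hy'b : y' ∈ closedBall q (4 * R + 10 - 2 * η) := mem_closedBall.2 (by linarith [dist_nonneg (x := y) (y := q)])
  obtain ⟨x, hx, hfx⟩ := hf.exists_dist_le hyb
  obtain ⟨x', hx', hfx'⟩ := hf.exists_dist_le hy'b
  -- a midpoint upstairs and its position
  obtain ⟨m, hm₁, hm₂⟩ := hmid i x x'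
  have hxp : dist x (p i) ≤ R + 2 := by
    have h1 := hf.le_dist_add hx hpi
    rw [hf.map_pt] at h1
    have h2 : dist (f x) q ≤ dist (f x) y + dist y q := dist_triangle _ _ _
    linarith [dist_nonneg (x := y') (y := q)]
  have hxx' : dist x x' ≤ dist y y' + 3 * η := by
    have h1 := hf.le_dist_add hx hx'
    have h2 : dist (f x) (f x') ≤ dist (f x) y + dist y y' + dist y' (f x') := dist_triangle4 _ _ _ _
    rw [dist_comm y' (f x')] at h2
    linarith
  have hyy' : dist y y' ≤ 2 * R := by
    have := dist_triangle y q y'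
    rw [dist_comm q y'] at this
    linarith
  have hmball : m ∈ closedBall (p i) (4 * R + 10) := by
    refine mem_closedBall.2 ?_
    calc dist m (p i) ≤ dist m x + dist x (p i) := dist_triangle _ _ _
      _ = dist x x' / 2 + dist x (p i) := by rw [dist_comm m x, hm₁]
      _ ≤ (2 * R + 3) / 2 + (R + 2) := by
          gcongr
          linarith
      _ ≤ 4 * R + 10 := by linarith
  -- the image of the midpoint is an approximate midpoint
  have hfm_x : dist (f m) (f x) ≤ dist x x' / 2 + η := by
    have := hf.dist_le hmball hx
    rw [dist_comm m x, hm₁] at this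
    exact this
  have hfm_x' : dist (f m) (f x') ≤ dist x x' / 2 + η := by
    have := hf.dist_le hmball hx'
    rw [hm₂] at this
    exact this
  have hup : dist y (f m) ≤ dist y y' / 2 + 4 * η := by
    have : dist y (f m) ≤ dist y (f x) + dist (f x) (f m) := dist_triangle _ _ _
    rw [dist_comm y (f x), dist_comm (f x) (f m)] at this
    linarith
  have hup' : dist (f m) y' ≤ dist y y' / 2 + 4 * η := by
    have : dist (f m) y' ≤ dist (f m) (f x') + dist (f x') y' := dist_triangle _ _ _
    linarith
  have hlo : dist y y' / 2 - 4 * η ≤ dist y (f m) := by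
    have : dist y y' ≤ dist y (f m) + dist (f m) y' := dist_triangle _ _ _
    linarith
  have hlo' : dist y y' / 2 - 4 * η ≤ dist (f m) y' := by
    have : dist y y' ≤ dist y (f m) + dist (f m) y' := dist_triangle _ _ _
    linarith
  refine ⟨f m, abs_le.2 ⟨by linarith, by linarith⟩, abs_le.2 ⟨by linarith, by linarith⟩⟩

/-- **Pointed Gromov–Hausdorff limits of spaces with midpoints are geodesic**: with `Y` proper,
any two points of `Y` are joined by a unit-speed minimal segment (`PointedGHConv.exists_midpoint`
and Menger's theorem `exists_segment_of_exists_midpoint`). This is the metric content of treating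
the limit `ℝˢ × Ŷ` of the covers `M̂ᵢ` in Huang–Huang–Wang–Zhu 2026, §4, as a geodesic space.
[cite: HuangHuangWangZhu2026, §4 pp. 13–14] -/
theorem PointedGHConv.exists_segment (h : PointedGHConv p q)
    (hmid : ∀ i, ∀ x x' : X i, ∃ m, dist x m = dist x x' / 2 ∧ dist m x' = dist x x' / 2)
    (y y' : Y) :
    ∃ σ : ℝ → Y, σ 0 = y ∧ σ (dist y y') = y' ∧
      ∀ s ∈ Icc 0 (dist y y'), ∀ t ∈ Icc 0 (dist y y'), dist (σ s) (σ t) = |s - t| :=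
  exists_segment_of_exists_midpoint (fun a b ↦ h.exists_midpoint hmid a b) y y'

/-- **Pointed Gromov–Hausdorff limits of geodesic spaces are geodesic** (the `Xᵢ` given by
unit-speed minimal segments, e.g. complete Riemannian manifolds and their covers,
`exists_segment_cyclicCover`). [cite: HuangHuangWangZhu2026, §4 pp. 13–14] -/
theorem PointedGHConv.exists_segment_of_forall_exists_segment (h : PointedGHConv p q)
    (hgeod : ∀ i, ∀ x x' : X i, ∃ σ : ℝ → X i, σ 0 = x ∧ σ (dist x x') = x' ∧
      ∀ s ∈ Icc 0 (dist x x'), ∀ t ∈ Icc 0 (dist x x'), dist (σ s) (σ t) = |s - t|)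
    (y y' : Y) :
    ∃ σ : ℝ → Y, σ 0 = y ∧ σ (dist y y') = y' ∧
      ∀ s ∈ Icc 0 (dist y y'), ∀ t ∈ Icc 0 (dist y y'), dist (σ s) (σ t) = |s - t| := by
  refine h.exists_segment (fun i x x' ↦ ?_) y y'
  obtain ⟨σ, h0, h1, hσ⟩ := hgeod i x x'
  exact exists_midpoint_of_segment h0 h1 hσ

end Literature.Geometry.MetricGeometry
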